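import Summits.Langlands.Langlands.Theses.HeptagonalTower
import Literature.NumberTheory.EllipticCurves.PlusMinusPAdicLFunction

/-!
# Birth skeleton (BC3) for crux stmt-Langlands-16986
`Summit.Langlands.Langlands.Theses.HeptagonalTower.NonvanishingSevenTwists` — line `birth`

Route `route-Langlands-HeptagonalTower` (`closes (hNV : NonvanishingSevenTwists) (hK : KatoRankZeroSeven)
(hD : OddDegreeDoor) (hT : TorsionSeven) (hC : SectorComplement) : Langlands`; this crux is `hNV`, rank 2).

THE CRUX (computational certificate): for `E = X₀(15)` in the Legendre model
`⟨0, 41, 0, 400, 0⟩ : WeierstrassCurve ℚ` and every EVEN PRIMITIVE Dirichlet character `χ` of conductor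
`7^{k+1}`, every entire function agreeing on `re s > 2` with the twisted Hasse–Weil series
`∑ χ(n) aₙ(E) n⁻ˢ` (Mathlib `WeierstrassCurve.LFunction` coefficients) is non-zero at `s = 1`.

This file concludes the crux BY NAME from FOUR named stubs along the route's own two-layer plan
(`UnitConstantTerms → PollackInterpolation → NonvanishingSevenTwists`), re-cut so that every stub is
TRUE AS STATED also on the tame branches (where the naive "unit constant term" shape fails: for a tame
character `ψ` of conductor exactly `7` the plus function has a FORCED zero at `T = 0`, `L₇⁺(f, ψ, 0) = 0`,
because the interpolation formula at conductor `p` carries an odd power of `α = √-7`; see STUB 4):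

* `stub_modularityLevel15` (M/L; Eichler–Shimura at level 15 in Mathlib's normalisation) — there is a
  newform `f ∈ S₂(Γ₀(15))` with `aₙ(f) = aₙ(E)` for ALL `n` (`IsNewformOf E f`: the tree's modularity
  glue, here for ONE curve; the Legendre model is non-minimal at `2` (`Δ = 2¹² · 3⁴ · 5⁴`), Mathlib's
  `LFunction` takes local factors of minimal models, so `aₙ(E) = aₙ(15a1) = aₙ(f₁₅)`,
  `f₁₅ = η(z)η(3z)η(5z)η(15z)`). In the tree this is `exists_isNewformOf` (BCDT, named fact) at
  `W.conductorNorm ℤ = 15` (Tate's algorithm at 2, 3, 5), or a direct level-15 argument.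
* `stub_birchBridge` (L; Birch–Manin, the bridge from complex `L`-values to rational symbol sums) — for
  such an `f`: `Ω⁺_f > 0` and, for every primitive even `χ` mod `m` and every entire `L` agreeing with
  `∑ χ(n) aₙ(E) n⁻ˢ` on `re s > 2`, BIRCH'S FORMULA `(∑_a χ̄(a) [a/m]⁺_f) · Ω⁺_f = τ(χ̄) · L(1)`
  (`ratTwistedSymbolSum f χ⁻¹`, `plusPeriod f`, `gaussSum χ⁻¹ stdAddChar`). In the tree: the named facts
  `ratTwistedSymbolSum_mul_plusPeriod` (MTT §I.8 (8.6)) at `χ⁻¹` (primitive: `conductor_inv`; even) with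
  `twistedLSeries f (χ⁻¹)⁻¹ = LSeries (χ · aₙ(E))` by `IsNewformOf`, `IsNewform0.plusPeriod_pos`
  (Cremona §2.8) and `coeffField f = ⊥` (integral coefficients).
* `stub_wildCertificate` (M; IN PRINT — the `ω⁰` branch) — for such an `f`, every primitive even `χ` of
  conductor `7^{k+1}` of `7`-POWER ORDER has `∑_a χ(a) [a/7^{k+1}]⁺_f ≠ 0`. Route: `k = 0` is vacuous (a
  `7`-power-order character of `(ℤ/7)ˣ` is trivial); for `k ≥ 1`, Pollack's `L₇^± ∈ ℤ₇⟦T⟧` for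
  (`15a1`, `p = 7`, `a₇ = 0`: `#X₀(15)(𝔽₇) = 8`) — tree fact `pollack_exists_plusMinusPAdicLFunction` with
  its PROVED corollary `….hasSum_zero_of_ratTwistedSymbolSum_eq_zero` (a vanishing wild Birch sum is a
  zero `χ(γ) - 1` of `L⁺`/`L⁻` in the open disc) — and the UNIT CONSTANT TERMS `L⁻(0) = -θ₀ = (2 - a₇)[0]⁺
  = 1/4`, `L⁺(0) = -θ₁(0) = (7 - 1)[0]⁺ = 3/4` (`[0]⁺ = L(E,1)/Ω⁺ = 1/8`; Hecke relation at `7`), both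
  `7`-adic units, so `L^±` are units of `ℤ₇⟦T⟧` and have no zero in the open unit disc of `ℂ₇`
  (`|∑_{k≥1} l_k z^k| < 1 = |l₀|`). Transfer `ℂ ↔ ℂ₇` of `χ` along a field isomorphism fixing `ℚ` (the sum
  is `∑ χ(a) ·` rational). Kurihara's criterion `p ∤ L(E,1)/Ω`, `p ∤ Tam` for supersingular `p` is the same
  statement; Thorne 2019 Thm 5 uses it for `15a1` at `p = 7`.
* `stub_tameCertificate` (L; NEW — the `ω²`, `ω⁴` branches, THE BET of the route) — the same
  non-vanishing for the primitive even `χ` of conductor `7^{k+1}` NOT of `7`-power order (tame part cubic: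
  the cubic pair at conductor `7` and their `3·7^k - 3·7^{k-1}`… wild multiples). Route: plus/minus `7`-adic
  `L`-functions on the tame-even branches `ω^i`, `i = 2, 4` (NOT vendored: Pollack 2003 Thm 5.1 treats tame
  conductor PRIME TO `p`; the `ω^i`-branches of the MTT measure on `ℤ₇ˣ` need the branchwise Prop. 6.18),
  integrality in `ℤ₇⟦T⟧` (`ω^i` is `ℤ₇`-valued), and the finite data: `L⁻_i(0) = ±∑_{a mod 7} ω^i(a)[a/7]⁺`
  (the conductor-`7` cubic Birch sums; the planner's numerics give algebraic part EXACTLY `2`, a unit) and,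
  since `L⁺_i(0) = -θ₁^{(i)}(0) = [0]⁺ · ∑_{b ∈ (ℤ/7)ˣ} ω^i(b) · (a₇ - 1)… = 0` is FORCED, the first
  Taylor coefficient of `L⁺_i` at `T = 0` (from `θ₁^{(i)}'(0)`, i.e. the 42 symbols `[a/49]⁺ mod 7`) must be
  a unit — or, failing `λ = (0|1)`, finitely many exact Birch sums at the candidate zero levels. Local
  numerics at filing (route header): all `2 + 18 + 126 + 882` even primitive twists of conductor `≤ 7⁴` are
  non-zero. Why it might fail: a cubic-tame twist may genuinely vanish (David–Fearnley–Kisilevsky thin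
  sets), or `μ > 0` / an unlucky Newton slope defeats the finite certificate (the crux's own why-might-fail).
* `NonvanishingSevenTwists_of : stubs 1–4 → NonvanishingSevenTwists` — kernel-checked, no `sorry`: given
  `k, χ, L`, take `f` from STUB 1; STUB 2 gives `S(χ̄) · Ω⁺ = τ(χ̄) · L(1)` with `Ω⁺ > 0`; `χ̄ = χ⁻¹` is
  primitive (`DirichletCharacter.conductor_inv`) and even (`MulChar.inv_apply_eq_inv'`), so `S(χ̄) ≠ 0` by
  STUB 3 or STUB 4 according as `χ̄` has `7`-power order or not; hence `L(1) = 0` would force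
  `S(χ̄) · Ω⁺ = 0`, absurd.

Shape (for `ledger skeleton check` / `#h21_check_skeleton`): stubs are `theorem stub_<name> : <goal> := by
sorry`; `_Goal.stub_<name> : Prop := type_of% @stub_<name>` names each statement; the composition takes
`(h₁ : _Goal.stub_modularityLevel15) … (h₄ : _Goal.stub_tameCertificate)` and concludes the route decl by
name; the final `example` feeds the four stubs to it. Sorries: exactly the four stubs.

Neither stub is the crux or the summit in costume: STUB 1 is modularity of one curve, STUB 2 an identity
between an `L`-value and a symbol sum (no non-vanishing), STUBS 3–4 are statements about RATIONAL modular
symbols with no `L`-function in them (they give the crux only through STUBS 1–2); the BC3 probes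
`stub → NonvanishingSevenTwists` / `stub → Langlands` by `first | exact? | simpa | aesop` fail (bc/ probes,
NOTES.md of the registering seat).

Disproof used: none relevant — the crux has no `Disproof.lean` / Negative lemma at registration
(`ledger crux ls stmt-Langlands-16986`: no workfiles); the summit's negatives index (OrdinaryPrimeTransport
pole count, K3 Serre-type anchor) does not touch twisted `L`-values of `X₀(15)`. Honoured instead: the
grounder notes on the item (g74-1/g74-3, 2026-08-17: "ω⁰ branch follows in print from Pollack + `L(E,1)/Ω =
1/8`; Δ-branches ω², ω⁴ NOT in print, not vendored") — exactly the STUB 3 / STUB 4 cut — and the route's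
why-might-fail (vanishing cubic twist; `μ > 0`; unbuilt `LFunction` API) — STUB 4 / STUB 4 / STUB 1.

Leans on (by name): `Summit.Langlands.Langlands.Theses.HeptagonalTower.NonvanishingSevenTwists` (the crux),
`Literature.NumberTheory.EllipticCurves.ModularForms.IsNewformOf`, `….plusPeriod`,
`Literature.NumberTheory.EllipticCurves.ratTwistedSymbolSum` / `ratPlusSymbol`, Mathlib `WeierstrassCurve.LFunction`,
`LSeries`, `DirichletCharacter.IsPrimitive/Even/conductor_inv`, `gaussSum`, `ZMod.stdAddChar`,
`MulChar.inv_apply_eq_inv'`; proof-time (inside the stubs): `exists_isNewformOf`,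
`ratTwistedSymbolSum_mul_plusPeriod`, `IsNewform0.plusPeriod_pos`, `ratCast_ratPlusSymbol`,
`pollack_exists_plusMinusPAdicLFunction` (+ PROVED `.interpolation`, `.hasSum_zero_of_ratTwistedSymbolSum_eq_zero`),
`MemIwasawaRat.finite_setOf_hasSum_zero`.
-/

-- `Summit.Langlands.Langlands.…`: summit = sub-problem name (D-0017 nested layout), not a typo.
set_option linter.dupNamespace false

noncomputable section

open scoped MatrixGroups ModularForm
open CongruenceSubgroup
open Literature.NumberTheory.EllipticCurves Literature.NumberTheory.EllipticCurves.ModularForms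
open Summit.Langlands.Langlands.Theses.HeptagonalTower

namespace Summit.Langlands.Langlands.Cruxes.NonvanishingSevenTwists.Birth

/-! ## 1. The stubs (the ONLY sorries of this file) -/

/-- **STUB 1 — modularity of `X₀(15)` in Mathlib's normalisation** (M/L). There is a newform
`f ∈ S₂(Γ₀(15))` whose `q`-expansion coefficients are the Dirichlet coefficients of Mathlib's Hasse–Weil
`L`-function of the Legendre model `y² = x³ + 41x² + 400x` of `X₀(15)` (`IsNewformOf`: `IsNewform0 f ∧ ∀ n,
aₙ(f) = W.LFunction n`). Eichler–Shimura at level `15` (genus one, `f₁₅ = η(z)η(3z)η(5z)η(15z)`), or the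
tree's `exists_isNewformOf` at `conductorNorm = 15`; the labour is unfolding `WeierstrassCurve.LFunction`
(local factors of minimal models; the Legendre model is non-minimal at `2`) to `aₙ(15a1)`.
[cite: DiamondShurman2005, Thm. 8.8.3] [cite: BreuilConradDiamondTaylor2001, Thm. A] -/
theorem stub_modularityLevel15 :
    ∃ f : CuspForm (Gamma0 15) 2,
      IsNewformOf ({ a₁ := 0, a₂ := 41, a₃ := 0, a₄ := 400, a₆ := 0 } : WeierstrassCurve ℚ) f := by
  sorry

/-- **STUB 2 — Birch's formula for `X₀(15)` (the bridge from `L(E, χ, 1)` to rational symbol sums)** (L).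
For the newform `f` of the Legendre model: `Ω⁺_f > 0`, and for every primitive even Dirichlet character
`χ` mod `m` and every entire `L` agreeing with `∑ χ(n) aₙ(E) n⁻ˢ` on `re s > 2`,
`(∑_{a mod m} χ̄(a) [a/m]⁺_f) · Ω⁺_f = τ(χ̄) · L(1)` (`χ̄ = χ⁻¹`; `[·]⁺_f = ratPlusSymbol f`, MTT
conventions `[0]⁺ = L(f,1)/Ω⁺_f`). In the tree: `ratTwistedSymbolSum_mul_plusPeriod` at `χ⁻¹`,
`IsNewform0.plusPeriod_pos`, `coeffField f = ⊥`.
[cite: MazurTateTeitelbaum1986Invent, §I.8 (8.6)] [cite: CremonaAlgorithms1997, §2.8] -/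
theorem stub_birchBridge :
    ∀ f : CuspForm (Gamma0 15) 2,
      IsNewformOf ({ a₁ := 0, a₂ := 41, a₃ := 0, a₄ := 400, a₆ := 0 } : WeierstrassCurve ℚ) f →
        0 < plusPeriod f ∧
        ∀ (m : ℕ) [NeZero m] (χ : DirichletCharacter ℂ m), χ.IsPrimitive → χ.Even →
          ∀ L : ℂ → ℂ, Differentiable ℂ L →
            (∀ s : ℂ, 2 < s.re → L s = LSeries (fun n ↦ χ n * ((({ a₁ := 0, a₂ := 41, a₃ := 0, a₄ := 400, a₆ := 0 } : WeierstrassCurve ℚ).LFunction n : ℤ) : ℂ)) s) →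
            (ratTwistedSymbolSum f χ⁻¹ : ℂ) * (plusPeriod f : ℂ) =
              gaussSum χ⁻¹ (ZMod.stdAddChar (N := m)) * L 1 := by
  sorry

/-- **STUB 3 — the wild-branch certificate (`ω⁰`: characters of `7`-power order)** (M; in print). For
the newform `f` of the Legendre model and every primitive even Dirichlet character `χ` of conductor
`7^{k+1}` of `7`-power order, Birch's sum `∑_{a mod 7^{k+1}} χ(a) [a/7^{k+1}]⁺_f` is non-zero. Route:
`k = 0` vacuous; for `k ≥ 1` Pollack's `L₇^± ∈ ℤ₇⟦T⟧` of `15a1` (`a₇ = 0`) have UNIT constant terms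
`L⁺(0) = 6[0]⁺ = 3/4`, `L⁻(0) = 2[0]⁺ = 1/4` (`[0]⁺ = 1/8`), hence no zeros in the open disc, while a
vanishing wild Birch sum would be a zero `χ(γ) - 1` (tree: `pollack_exists_plusMinusPAdicLFunction` and its
proved corollary `hasSum_zero_of_ratTwistedSymbolSum_eq_zero`; transfer `ℂ ↔ ℂ₇` along a field
isomorphism, the sum being `∑ χ(a) ·` rational). [cite: Pollack2003, Thm. 5.6, Cor. 5.11 and Prop. 6.18]
[cite: Kurihara2002] [cite: Thorne2019, Thm. 5] -/
theorem stub_wildCertificate :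
    ∀ f : CuspForm (Gamma0 15) 2,
      IsNewformOf ({ a₁ := 0, a₂ := 41, a₃ := 0, a₄ := 400, a₆ := 0 } : WeierstrassCurve ℚ) f →
        ∀ (k : ℕ) (χ : DirichletCharacter ℂ (7 ^ (k + 1))), χ.IsPrimitive → χ.Even →
          (∃ j : ℕ, orderOf χ = 7 ^ j) → ratTwistedSymbolSum f χ ≠ 0 := by
  sorry

/-- **STUB 4 — the tame-branch certificate (`ω²`, `ω⁴`: characters NOT of `7`-power order)** (L; NEW,
the bet of the route). For the newform `f` of the Legendre model and every primitive even Dirichlet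
character `χ` of conductor `7^{k+1}` whose order is not a power of `7` (tame part the cubic characters of
`(ℤ/7)ˣ`), Birch's sum `∑_a χ(a) [a/7^{k+1}]⁺_f` is non-zero. Route: plus/minus `7`-adic `L`-functions on the
branches `ω^i`, `i = 2, 4` (branchwise Prop. 6.18, not vendored), integral since `ω^i` is `ℤ₇`-valued, with
`L⁻_i(0) = ±` (conductor-`7` cubic Birch sum) a unit and — `L⁺_i(0) = 0` being FORCED at conductor `p` —
a unit FIRST Taylor coefficient of `L⁺_i` (the 42 symbols `[a/49]⁺ mod 7`); else finitely many exact Birch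
sums at the candidate zero levels. Why it might fail: a cubic-tame twist may vanish; `μ > 0`.
[cite: Pollack2003, Thm. 5.1 and Prop. 6.18] [cite: MazurTateTeitelbaum1986Invent, §I.8] -/
theorem stub_tameCertificate :
    ∀ f : CuspForm (Gamma0 15) 2,
      IsNewformOf ({ a₁ := 0, a₂ := 41, a₃ := 0, a₄ := 400, a₆ := 0 } : WeierstrassCurve ℚ) f →
        ∀ (k : ℕ) (χ : DirichletCharacter ℂ (7 ^ (k + 1))), χ.IsPrimitive → χ.Even →
          (¬ ∃ j : ℕ, orderOf χ = 7 ^ j) → ratTwistedSymbolSum f χ ≠ 0 := by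
  sorry

/-! ## 2. The stub statements as named propositions (hypotheses of the composition, by name) -/

namespace _Goal

/-- The statement of `stub_modularityLevel15` (literally its type). [folklore] -/
@[folklore] def stub_modularityLevel15 : Prop :=
  type_of% @Summit.Langlands.Langlands.Cruxes.NonvanishingSevenTwists.Birth.stub_modularityLevel15

/-- The statement of `stub_birchBridge` (literally its type). [folklore] -/
@[folklore] def stub_birchBridge : Prop :=
  type_of% @Summit.Langlands.Langlands.Cruxes.NonvanishingSevenTwists.Birth.stub_birchBridge

/-- The statement of `stub_wildCertificate` (literally its type). [folklore] -/
@[folklore] def stub_wildCertificate : Prop :=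
  type_of% @Summit.Langlands.Langlands.Cruxes.NonvanishingSevenTwists.Birth.stub_wildCertificate

/-- The statement of `stub_tameCertificate` (literally its type). [folklore] -/
@[folklore] def stub_tameCertificate : Prop :=
  type_of% @Summit.Langlands.Langlands.Cruxes.NonvanishingSevenTwists.Birth.stub_tameCertificate

end _Goal

/-! ## 3. Composition (kernel-checked, no `sorry`): STUBS 1–4 ⟹ `NonvanishingSevenTwists` BY NAME -/

/-- **`NonvanishingSevenTwists` from the four stubs.** Given `k`, an even primitive `χ` mod `7^{k+1}` and
an entire `L` agreeing with `∑ χ(n) aₙ(E) n⁻ˢ` on `re s > 2`: take the newform `f` of STUB 1; STUB 2 gives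
`S(χ⁻¹) · Ω⁺_f = τ(χ⁻¹) · L 1` with `Ω⁺_f > 0`; `χ⁻¹` is primitive (`conductor_inv`) and even, so
`S(χ⁻¹) ≠ 0` by STUB 3 (if `χ⁻¹` has `7`-power order) or STUB 4 (otherwise); if `L 1 = 0` then
`S(χ⁻¹) · Ω⁺_f = 0`, contradiction. [folklore] -/
theorem NonvanishingSevenTwists_of (h₁ : _Goal.stub_modularityLevel15) (h₂ : _Goal.stub_birchBridge)
    (h₃ : _Goal.stub_wildCertificate) (h₄ : _Goal.stub_tameCertificate) : NonvanishingSevenTwists := by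
  have H₁ : ∃ f : CuspForm (Gamma0 15) 2,
      IsNewformOf ({ a₁ := 0, a₂ := 41, a₃ := 0, a₄ := 400, a₆ := 0 } : WeierstrassCurve ℚ) f := h₁
  have H₂ : ∀ f : CuspForm (Gamma0 15) 2,
      IsNewformOf ({ a₁ := 0, a₂ := 41, a₃ := 0, a₄ := 400, a₆ := 0 } : WeierstrassCurve ℚ) f →
        0 < plusPeriod f ∧
        ∀ (m : ℕ) [NeZero m] (χ : DirichletCharacter ℂ m), χ.IsPrimitive → χ.Even →
          ∀ L : ℂ → ℂ, Differentiable ℂ L →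
            (∀ s : ℂ, 2 < s.re → L s = LSeries (fun n ↦ χ n * ((({ a₁ := 0, a₂ := 41, a₃ := 0, a₄ := 400, a₆ := 0 } : WeierstrassCurve ℚ).LFunction n : ℤ) : ℂ)) s) →
            (ratTwistedSymbolSum f χ⁻¹ : ℂ) * (plusPeriod f : ℂ) =
              gaussSum χ⁻¹ (ZMod.stdAddChar (N := m)) * L 1 := h₂
  have H₃ : ∀ f : CuspForm (Gamma0 15) 2,
      IsNewformOf ({ a₁ := 0, a₂ := 41, a₃ := 0, a₄ := 400, a₆ := 0 } : WeierstrassCurve ℚ) f →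
        ∀ (k : ℕ) (χ : DirichletCharacter ℂ (7 ^ (k + 1))), χ.IsPrimitive → χ.Even →
          (∃ j : ℕ, orderOf χ = 7 ^ j) → ratTwistedSymbolSum f χ ≠ 0 := h₃
  have H₄ : ∀ f : CuspForm (Gamma0 15) 2,
      IsNewformOf ({ a₁ := 0, a₂ := 41, a₃ := 0, a₄ := 400, a₆ := 0 } : WeierstrassCurve ℚ) f →
        ∀ (k : ℕ) (χ : DirichletCharacter ℂ (7 ^ (k + 1))), χ.IsPrimitive → χ.Even →
          (¬ ∃ j : ℕ, orderOf χ = 7 ^ j) → ratTwistedSymbolSum f χ ≠ 0 := h₄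
  intro k χ hprim heven L hL hagree
  obtain ⟨f, hf⟩ := H₁
  obtain ⟨hΩ, hbridge⟩ := H₂ f hf
  haveI : NeZero (7 ^ (k + 1)) := ⟨pow_ne_zero _ (by norm_num)⟩
  have key := hbridge (7 ^ (k + 1)) χ hprim heven L hL hagree
  -- `χ⁻¹` is primitive and even
  have hprim' : χ⁻¹.IsPrimitive := by
    rw [DirichletCharacter.IsPrimitive, DirichletCharacter.conductor_inv]
    exact hprim
  have heven' : χ⁻¹.Even := by
    change χ⁻¹ (-1) = 1
    rw [MulChar.inv_apply_eq_inv']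
    have h1 : χ (-1) = 1 := heven
    rw [h1, inv_one]
  -- the symbol sum of `χ⁻¹` does not vanish (wild or tame certificate)
  have hS : (ratTwistedSymbolSum f χ⁻¹ : ℂ) ≠ 0 := by
    by_cases hw : ∃ j : ℕ, orderOf χ⁻¹ = 7 ^ j
    · exact H₃ f hf k χ⁻¹ hprim' heven' hw
    · exact H₄ f hf k χ⁻¹ hprim' heven' hw
  -- conclude
  intro h0
  rw [h0, mul_zero] at key
  rcases mul_eq_zero.mp key with h | h
  · exact hS h
  · exact (ne_of_gt hΩ) (Complex.ofReal_eq_zero.mp h)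

/-- By-name sanity check (an `example`, not a declaration): the four stubs feed the composition. -/
example : NonvanishingSevenTwists :=
  NonvanishingSevenTwists_of stub_modularityLevel15 stub_birchBridge stub_wildCertificate
    stub_tameCertificate

/-- Read-back: the conclusion of `NonvanishingSevenTwists_of` is the route decl, which unfolds to the
verbatim crux text used to cut the stubs. [bookkeeping] -/
example : NonvanishingSevenTwists ↔
    ∀ (k : ℕ) (χ : DirichletCharacter ℂ (7 ^ (k + 1))), χ.IsPrimitive → χ (-1) = 1 → ∀ L : ℂ → ℂ, Differentiable ℂ L → (∀ s : ℂ, 2 < s.re → L s = LSeries (fun n ↦ χ n * ((({ a₁ := 0, a₂ := 41, a₃ := 0, a₄ := 400, a₆ := 0 } : WeierstrassCurve ℚ).LFunction n : ℤ) : ℂ)) s) → L 1 ≠ 0 :=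
  Iff.rfl

end Summit.Langlands.Langlands.Cruxes.NonvanishingSevenTwists.Birth

end
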